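import Literature.Computability.ImplicitComplexity.SoftTypeAssignmentSubst
import HarnessLib

/-!
# `STA₊` terms: size, free variables, and the renamings of the multiplexor

Bookkeeping on the de Bruijn terms `STA.Term` of `SoftTypeAssignment.lean` (GMR08 = Gaboardi–
Marion–Ronchi Della Rocca 2008) used by the structural theory of typing derivations (renaming,
weakening/strengthening, subject reduction with the weight measures of GMR08 Def. A.1):

* `STA.Term.size` — the size `|M|` (number of symbols, GMR08 §3.1 / Def. A.1), invariant under
  renaming;
* `STA.Term.fv` — the finite set of free de Bruijn indices of a term, its behaviour under the
  constructors, renaming and substitution (`mem_fv_rename`, `mem_fv_substp`), the bound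
  `|FV(M)| ≤ |M|`, and the extensionality principles "a renaming/substitution acting as the
  identity on `FV(M)` does not change `M`" (`rename_congr_fv`, `substp_congr_fv`);
* the renaming `mpxRen S j` of rule `(m)` and its context operation `Ctx.mpx`: the degenerate
  case `S = ∅` (which is weakening by a modal assumption, GMR08 §2: "the weakening rule is a
  particular case of multiplexor, with n = 0") and lifting under a binder.

All folklore.

## References

* [GaboardiMarionRonchidellarocca2008] GMR08, Def. 3.1, Table 2 `(m)`, §3.1 and Def. A.1 (`|M|`).
-/

namespace Literature.Computability.ImplicitComplexity

namespace STA

namespace Term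

/-! ### Size -/

/-- The size `|M|` of a term: its number of symbols. [cite: GaboardiMarionRonchidellarocca2008, Def. A.1] -/
def size : Term → ℕ
  | .var _ => 1
  | .app M N => M.size + N.size + 1
  | .lam M => M.size + 1
  | .sum M N => M.size + N.size + 1

/-- Every term has positive size. [folklore] -/
theorem size_pos (M : Term) : 0 < M.size := by
  cases M <;> simp [size]

/-- Renaming (in particular rule `(m)`'s `M[x/x₁,…,x/xₙ]`) preserves the size.
[cite: GaboardiMarionRonchidellarocca2008, §3 (comment on rule (m))] -/
theorem size_rename (M : Term) (ρ : ℕ → ℕ) : (M.rename ρ).size = M.size := by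
  induction M generalizing ρ with
  | var i => rfl
  | app M N ihM ihN => simp [Term.rename, size, ihM, ihN]
  | lam M ih => simp [Term.rename, size, ih]
  | sum M N ihM ihN => simp [Term.rename, size, ihM, ihN]

/-! ### Free variables -/

/-- The finite set of free de Bruijn indices of a term. [folklore] -/
def fv : Term → Finset ℕ
  | .var i => {i}
  | .app M N => M.fv ∪ N.fv
  | .lam M => (M.fv.erase 0).image Nat.pred
  | .sum M N => M.fv ∪ N.fv

/-- Free variables of a variable. [folklore] -/
@[simp] theorem mem_fv_var {i j : ℕ} : i ∈ (Term.var j).fv ↔ i = j := Finset.mem_singleton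

/-- Free variables of an application. [folklore] -/
@[simp] theorem mem_fv_app {i : ℕ} {M N : Term} : i ∈ (Term.app M N).fv ↔ i ∈ M.fv ∨ i ∈ N.fv :=
  Finset.mem_union

/-- Free variables of a sum. [folklore] -/
@[simp] theorem mem_fv_sum {i : ℕ} {M N : Term} : i ∈ (Term.sum M N).fv ↔ i ∈ M.fv ∨ i ∈ N.fv :=
  Finset.mem_union

/-- Free variables of an abstraction: index `i` outside is index `i + 1` inside. [folklore] -/
@[simp] theorem mem_fv_lam {i : ℕ} {M : Term} : i ∈ (Term.lam M).fv ↔ i + 1 ∈ M.fv := by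
  simp only [fv, Finset.mem_image, Finset.mem_erase]
  constructor
  · rintro ⟨j, ⟨hj0, hj⟩, rfl⟩
    obtain ⟨k, rfl⟩ := Nat.exists_eq_succ_of_ne_zero hj0
    exact hj
  · intro h
    exact ⟨i + 1, ⟨Nat.succ_ne_zero i, h⟩, rfl⟩

/-- A term has at most `|M|` free variables. [folklore] -/
theorem card_fv_le_size (M : Term) : M.fv.card ≤ M.size := by
  induction M with
  | var i => simp [fv, size]
  | app M N ihM ihN => exact (Finset.card_union_le _ _).trans (by simp [size]; omega)
  | lam M ih =>
    exact Finset.card_image_le.trans ((Finset.card_erase_le).trans (ih.trans (by simp [size])))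
  | sum M N ihM ihN => exact (Finset.card_union_le _ _).trans (by simp [size]; omega)

/-- Free variables of a renamed term. [folklore] -/
theorem mem_fv_rename {M : Term} {ρ : ℕ → ℕ} {i : ℕ} :
    i ∈ (M.rename ρ).fv ↔ ∃ j ∈ M.fv, ρ j = i := by
  induction M generalizing ρ i with
  | var j =>
    simp only [Term.rename, mem_fv_var, exists_eq_left]
    exact eq_comm
  | app M N ihM ihN =>
    simp only [Term.rename, mem_fv_app, ihM, ihN]
    constructor
    · rintro (⟨j, hj, rfl⟩ | ⟨j, hj, rfl⟩)
      · exact ⟨j, Or.inl hj, rfl⟩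
      · exact ⟨j, Or.inr hj, rfl⟩
    · rintro ⟨j, hj | hj, rfl⟩
      · exact Or.inl ⟨j, hj, rfl⟩
      · exact Or.inr ⟨j, hj, rfl⟩
  | lam M ih =>
    simp only [Term.rename, mem_fv_lam, ih]
    constructor
    · rintro ⟨j, hj, hji⟩
      cases j with
      | zero => exact absurd hji (by simp [liftRen])
      | succ j =>
        refine ⟨j, hj, ?_⟩
        simpa [liftRen] using hji
    · rintro ⟨j, hj, rfl⟩
      exact ⟨j + 1, hj, rfl⟩
  | sum M N ihM ihN =>
    simp only [Term.rename, mem_fv_sum, ihM, ihN]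
    constructor
    · rintro (⟨j, hj, rfl⟩ | ⟨j, hj, rfl⟩)
      · exact ⟨j, Or.inl hj, rfl⟩
      · exact ⟨j, Or.inr hj, rfl⟩
    · rintro ⟨j, hj | hj, rfl⟩
      · exact Or.inl ⟨j, hj, rfl⟩
      · exact Or.inr ⟨j, hj, rfl⟩

/-- Free variables of a substituted term. [folklore] -/
theorem mem_fv_substp {M : Term} {τ : ℕ → Term} {i : ℕ} :
    i ∈ (M.substp τ).fv ↔ ∃ j ∈ M.fv, i ∈ (τ j).fv := by
  induction M generalizing τ i with
  | var j => simp [Term.substp]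
  | app M N ihM ihN =>
    simp only [Term.substp, mem_fv_app, ihM, ihN]
    constructor
    · rintro (⟨j, hj, h⟩ | ⟨j, hj, h⟩)
      · exact ⟨j, Or.inl hj, h⟩
      · exact ⟨j, Or.inr hj, h⟩
    · rintro ⟨j, hj | hj, h⟩
      · exact Or.inl ⟨j, hj, h⟩
      · exact Or.inr ⟨j, hj, h⟩
  | lam M ih =>
    simp only [Term.substp, mem_fv_lam, ih]
    constructor
    · rintro ⟨j, hj, hji⟩
      cases j with
      | zero => exact absurd hji (by simp [Term.up])
      | succ j =>
        refine ⟨j, hj, ?_⟩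
        obtain ⟨m, hm, hmi⟩ := (mem_fv_rename (M := τ j)).1 hji
        obtain rfl : m = i := by simpa using hmi
        exact hm
    · rintro ⟨j, hj, h⟩
      exact ⟨j + 1, hj, (mem_fv_rename (M := τ j)).2 ⟨i, h, rfl⟩⟩
  | sum M N ihM ihN =>
    simp only [Term.substp, mem_fv_sum, ihM, ihN]
    constructor
    · rintro (⟨j, hj, h⟩ | ⟨j, hj, h⟩)
      · exact ⟨j, Or.inl hj, h⟩
      · exact ⟨j, Or.inr hj, h⟩
    · rintro ⟨j, hj | hj, h⟩
      · exact Or.inl ⟨j, hj, h⟩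
      · exact Or.inr ⟨j, hj, h⟩

/-- Free variables of `M[N/x]`: those of `M` other than `x` (lowered), and those of `N` if `x`
occurs. [folklore] -/
theorem mem_fv_subst0 {M N : Term} {i : ℕ} :
    i ∈ (M.subst0 N).fv ↔ i + 1 ∈ M.fv ∨ (0 ∈ M.fv ∧ i ∈ N.fv) := by
  unfold subst0
  rw [mem_fv_substp]
  constructor
  · rintro ⟨j, hj, h⟩
    cases j with
    | zero => exact Or.inr ⟨hj, h⟩
    | succ j =>
      obtain rfl : i = j := by simpa using h
      exact Or.inl hj
  · rintro (h | ⟨h0, h⟩)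
    · exact ⟨i + 1, h, by simp⟩
    · exact ⟨0, h0, h⟩

/-- Two renamings agreeing on the free variables act equally. [folklore] -/
theorem rename_congr_fv {M : Term} {ρ ρ' : ℕ → ℕ} (h : ∀ i ∈ M.fv, ρ i = ρ' i) :
    M.rename ρ = M.rename ρ' := by
  induction M generalizing ρ ρ' with
  | var i => simpa [Term.rename] using h i (by simp)
  | app M N ihM ihN =>
    simp only [Term.rename]
    rw [ihM fun i hi => h i (by simp [hi]), ihN fun i hi => h i (by simp [hi])]
  | lam M ih =>
    simp only [Term.rename]
    rw [ih]
    intro i hi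
    cases i with
    | zero => rfl
    | succ i => exact congrArg Nat.succ (h i (by simpa using hi))
  | sum M N ihM ihN =>
    simp only [Term.rename]
    rw [ihM fun i hi => h i (by simp [hi]), ihN fun i hi => h i (by simp [hi])]

/-- A renaming fixing the free variables does nothing. [folklore] -/
theorem rename_id_of_fv {M : Term} {ρ : ℕ → ℕ} (h : ∀ i ∈ M.fv, ρ i = i) : M.rename ρ = M :=
  (rename_congr_fv (ρ' := id) h).trans (rename_id M)

/-- Two substitutions agreeing on the free variables act equally. [folklore] -/
theorem substp_congr_fv {M : Term} {τ τ' : ℕ → Term} (h : ∀ i ∈ M.fv, τ i = τ' i) :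
    M.substp τ = M.substp τ' := by
  induction M generalizing τ τ' with
  | var i => simpa [Term.substp] using h i (by simp)
  | app M N ihM ihN =>
    simp only [Term.substp]
    rw [ihM fun i hi => h i (by simp [hi]), ihN fun i hi => h i (by simp [hi])]
  | lam M ih =>
    simp only [Term.substp]
    rw [ih]
    intro i hi
    cases i with
    | zero => rfl
    | succ i => exact congrArg (Term.rename Nat.succ) (h i (by simpa using hi))
  | sum M N ihM ihN =>
    simp only [Term.substp]
    rw [ihM fun i hi => h i (by simp [hi]), ihN fun i hi => h i (by simp [hi])]

/-- Substituting for a variable that does not occur: `M[N/x] = M↓` whatever `N`. [folklore] -/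
theorem subst0_congr_of_not_mem {M : Term} (h : 0 ∉ M.fv) (N N' : Term) : M.subst0 N = M.subst0 N' := by
  unfold subst0
  refine substp_congr_fv fun i hi => ?_
  cases i with
  | zero => exact absurd hi h
  | succ i => rfl

end Term

/-! ### The multiplexor's renaming and context operation -/

/-- On a contracted slot, `mpxRen S j` is `j`. [cite: GaboardiMarionRonchidellarocca2008, Table 2 (m)] -/
theorem mpxRen_of_mem {S : Finset ℕ} {j i : ℕ} (h : i ∈ S) : mpxRen S j i = j := by
  simp [mpxRen, h]

/-- Off the contracted slots, `mpxRen S j` is the identity. [cite: GaboardiMarionRonchidellarocca2008, Table 2 (m)] -/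
theorem mpxRen_of_not_mem {S : Finset ℕ} {j i : ℕ} (h : i ∉ S) : mpxRen S j i = i := by
  simp [mpxRen, h]

/-- The rank-`0` multiplexor renames nothing. [cite: GaboardiMarionRonchidellarocca2008, §2 (weakening is (m) with n = 0)] -/
theorem mpxRen_empty (j : ℕ) : mpxRen ∅ j = id := by
  funext i
  simp [mpxRen]

/-- Lifting the multiplexor's renaming under a binder is the multiplexor's renaming of the
shifted slots. [folklore] -/
theorem liftRen_mpxRen (S : Finset ℕ) (j : ℕ) :
    liftRen (mpxRen S j) = mpxRen (S.image Nat.succ) (j + 1) := by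
  funext i
  cases i with
  | zero =>
    have : (0 : ℕ) ∉ S.image Nat.succ := by simp
    simp [liftRen, mpxRen, this]
  | succ i =>
    by_cases h : i ∈ S
    · have : i + 1 ∈ S.image Nat.succ := Finset.mem_image.2 ⟨i, h, rfl⟩
      simp [liftRen, mpxRen, h, this]
    · have : i + 1 ∉ S.image Nat.succ := by simpa using h
      simp [liftRen, mpxRen, h, this]

/-- A term none of whose free variables is contracted is unchanged by rule `(m)`'s renaming.
[folklore] -/
theorem Term.rename_mpxRen_of_disjoint {M : Term} {S : Finset ℕ} (j : ℕ) (h : ∀ i ∈ M.fv, i ∉ S) :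
    M.rename (mpxRen S j) = M :=
  Term.rename_id_of_fv fun i hi => mpxRen_of_not_mem (h i hi)

namespace Ctx

/-- The rank-`0` multiplexor's context operation is the addition of one modal assumption `x : !σ`
(weakening by a modal type). [cite: GaboardiMarionRonchidellarocca2008, §2 and Table 2 (m)] -/
theorem mpx_empty (Γ : Ctx) (j : ℕ) (σ : SoftTy) : Γ.mpx ∅ j σ = Function.update Γ j (some σ.bang) := by
  funext i
  by_cases h : i = j
  · subst h
    simp [Ctx.mpx]
  · simp [Ctx.mpx, h]

/-- Value of `Γ.mpx S j σ` at a contracted slot. [folklore] -/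
theorem mpx_of_mem (Γ : Ctx) {S : Finset ℕ} {j i : ℕ} (σ : SoftTy) (h : i ∈ S) : Γ.mpx S j σ i = none := by
  simp [Ctx.mpx, h]

/-- Value of `Γ.mpx S j σ` at the fresh slot. [folklore] -/
theorem mpx_self (Γ : Ctx) {S : Finset ℕ} {j : ℕ} (σ : SoftTy) (h : j ∉ S) : Γ.mpx S j σ j = some σ.bang := by
  simp [Ctx.mpx, h]

/-- Value of `Γ.mpx S j σ` elsewhere. [folklore] -/
theorem mpx_of_ne (Γ : Ctx) {S : Finset ℕ} {j i : ℕ} (σ : SoftTy) (hS : i ∉ S) (hj : i ≠ j) :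
    Γ.mpx S j σ i = Γ i := by
  simp [Ctx.mpx, hS, hj]

/-- Entering a binder commutes with the multiplexor's context operation (slots shifted). [folklore] -/
theorem cons_mpx (a : Option SoftTy) (Γ : Ctx) (S : Finset ℕ) (j : ℕ) (σ : SoftTy) :
    Ctx.cons a (Γ.mpx S j σ) = (Ctx.cons a Γ).mpx (S.image Nat.succ) (j + 1) σ := by
  funext i
  cases i with
  | zero =>
    have : (0 : ℕ) ∉ S.image Nat.succ := by simp
    simp [Ctx.cons, Ctx.mpx, this]
  | succ i =>
    by_cases h : i ∈ S
    · have : i + 1 ∈ S.image Nat.succ := Finset.mem_image.2 ⟨i, h, rfl⟩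
      simp [Ctx.cons, Ctx.mpx, h, this]
    · have : i + 1 ∉ S.image Nat.succ := by simpa using h
      by_cases hj : i = j
      · subst hj
        simp [Ctx.cons, Ctx.mpx, h, this]
      · simp [Ctx.cons, Ctx.mpx, h, this, hj]

/-- `!`-ing a context commutes with entering a binder. [folklore] -/
theorem cons_bang (a : Option SoftTy) (Γ : Ctx) : Ctx.cons (a.map SoftTy.bang) Γ.bang = (Ctx.cons a Γ).bang := by
  funext i
  cases i <;> rfl

/-- The type-variable shift commutes with entering a binder. [folklore] -/
theorem cons_shift (a : Option SoftTy) (Γ : Ctx) : Ctx.cons (a.map SoftTy.shift) Γ.shift = (Ctx.cons a Γ).shift := by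
  funext i
  cases i <;> rfl

/-- Updating a shifted slot commutes with entering a binder. [folklore] -/
theorem cons_update (a : Option SoftTy) (Γ : Ctx) (j : ℕ) (b : Option SoftTy) :
    Ctx.cons a (Function.update Γ j b) = Function.update (Ctx.cons a Γ) (j + 1) b := by
  funext i
  cases i with
  | zero => simp [Ctx.cons]
  | succ i =>
    by_cases h : i = j
    · subst h
      simp [Ctx.cons]
    · simp [Ctx.cons, Function.update_of_ne h, Function.update_of_ne (show i + 1 ≠ j + 1 by omega)]

/-- A split of the outer context extends to a split under a binder, the new slot going left.
[folklore] -/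
theorem Split.cons_left {Γ Γ₁ Γ₂ : Ctx} (h : Γ.Split Γ₁ Γ₂) (a : Option SoftTy) :
    (Ctx.cons a Γ).Split (Ctx.cons a Γ₁) (Ctx.cons none Γ₂) := by
  intro i
  cases i with
  | zero => exact Or.inl ⟨rfl, rfl⟩
  | succ i => exact h i

/-- A split of the outer context extends to a split under a binder, the new slot going right.
[folklore] -/
theorem Split.cons_right {Γ Γ₁ Γ₂ : Ctx} (h : Γ.Split Γ₁ Γ₂) (a : Option SoftTy) :
    (Ctx.cons a Γ).Split (Ctx.cons none Γ₁) (Ctx.cons a Γ₂) := by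
  intro i
  cases i with
  | zero => exact Or.inr ⟨rfl, rfl⟩
  | succ i => exact h i

/-- Splits are symmetric. [folklore] -/
theorem Split.symm {Γ Γ₁ Γ₂ : Ctx} (h : Γ.Split Γ₁ Γ₂) : Γ.Split Γ₂ Γ₁ := fun i =>
  (h i).elim (fun h' => Or.inr ⟨h'.2, h'.1⟩) (fun h' => Or.inl ⟨h'.2, h'.1⟩)

/-- In a split, an assumption present on the left is the outer one and absent on the right. [folklore] -/
theorem Split.left_of_ne_none {Γ Γ₁ Γ₂ : Ctx} (h : Γ.Split Γ₁ Γ₂) {i : ℕ} (hi : Γ₁ i ≠ none) :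
    Γ₁ i = Γ i ∧ Γ₂ i = none := by
  rcases h i with h' | ⟨h₁, _⟩
  · exact h'
  · exact absurd h₁ hi

/-- In a split, an assumption present on the right is the outer one and absent on the left. [folklore] -/
theorem Split.right_of_ne_none {Γ Γ₁ Γ₂ : Ctx} (h : Γ.Split Γ₁ Γ₂) {i : ℕ} (hi : Γ₂ i ≠ none) :
    Γ₁ i = none ∧ Γ₂ i = Γ i := by
  rcases h i with ⟨_, h₂⟩ | h'
  · exact absurd h₂ hi
  · exact h'

/-- The trivial split: everything left. [folklore] -/
theorem Split.all_left (Γ : Ctx) : Γ.Split Γ Ctx.empty := fun _ => Or.inl ⟨rfl, rfl⟩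

/-- The trivial split: everything right. [folklore] -/
theorem Split.all_right (Γ : Ctx) : Γ.Split Ctx.empty Γ := fun _ => Or.inr ⟨rfl, rfl⟩

end Ctx

end STA

end Literature.Computability.ImplicitComplexity
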